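import Mathlib.CategoryTheory.Endomorphism
import Mathlib.Data.Int.Cast.Lemmas
import Mathlib.Algebra.Group.Basic
import Mathlib.Data.Set.Finite.Basic
import Literature.AnabelianGeometry.SemiGraphs.TreeSystemEscapeTrees
import HarnessLib

/-!
# Escape trees `Y_K`: folds, swaps and the action through an involution

Mochizuki, *Semi-graphs of anabelioids*, Publ. RIMS **42** (2006), §3, Theorem 3.7 (iii), manuscript
pp. 40–41 [cite: MochizukiSemiAnbd2006, Thm 3.7(iii) pp.40-41] (the «compatible system of vertices …
each of which is fixed by `H`», p. 41).  Second file of the escape-tower test object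
(`TreeSystemEscapeTrees.lean`): the FOLD morphisms `escapeFold : Y_{K'} ⟶ Y_K` (`K ≤ K'`; identity on the
line, the arm segment `[K, K')` folded onto the line) — functorial, surjective on vertices, finite fibres;
the SWAP involutions `escapeSwap K` (arm ↔ initial segment of the line, tail fixed) as automorphisms
`escapeSwapIso K`, the action `escapeAct K : Multiplicative ℤ →* Aut Y_K` through them, its fixed vertices
(exactly the tail `n ≥ K`, `escapeAct_fixed_iff`), and the EQUIVARIANCE of the folds
(`escapeAct_comp_escapeFold`).  All elementary.

Nothing in this file takes a side on [IUTchIII] Cor. 3.12; it asserts nothing about `π₁^temp`.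
-/

namespace Literature.AnabelianGeometry.SemiGraphs

open CategoryTheory

universe u

namespace SemiGraph

/-! ### The fold morphisms `Y_{K'} ⟶ Y_K` (`K ≤ K'`) and their functoriality -/

/-- Representatives are compatible for `K ≤ K'`. [cite: MochizukiSemiAnbd2006, Thm 3.7(iii) p.41] -/
theorem escRep_escRep {K K' : ℕ} (h : K ≤ K') (s : Bool) (n : ℕ) :
    escRep K (escRep K' s n).1.1 (escRep K' s n).1.2 = escRep K s n := by
  apply EscIdx.ext
  simp only [escRep_val, Prod.mk.injEq, and_true]
  by_cases h1 : n < K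
  · have h2 : n < K' := by omega
    simp [h1, h2]
  · simp [h1]

/-- The upper end of the folded edge is the fold of the upper end (`K ≤ K'`).
[cite: MochizukiSemiAnbd2006, Thm 3.7(iii) p.41] -/
theorem escRep_succ_fold {K K' : ℕ} (h : K ≤ K') (s : Bool) (n : ℕ) :
    escRep K (s && decide (n < K)) (n + 1) = escRep K (s && decide (n + 1 < K')) (n + 1) := by
  apply EscIdx.ext
  simp only [escRep_val, Prod.mk.injEq, and_true]
  by_cases h1 : n + 1 < K
  · have h2 : n < K := by omega
    have h3 : n + 1 < K' := by omega
    simp [h1, h2, h3]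
  · simp [h1]

/-- **The fold** `Y_{K'} ⟶ Y_K` for `K ≤ K'`: the identity on the line and on the arm below height `K`,
and the arm segment `[K, K')` folded onto the line. [cite: MochizukiSemiAnbd2006, Thm 3.7(iii) p.41] -/
def escapeFold {K K' : ℕ} (h : K ≤ K') : escapeTree K' ⟶ escapeTree K where
  vertexMap p := escRep K p.1.1 p.1.2
  edgeMap p := escRep K p.1.1 p.1.2
  branchMap b := (escRep K b.1.1.1 b.1.1.2, b.2)
  edgeOf_branchMap _ := rfl
  branchMap_injOn b₁ b₂ he hb := by
    obtain ⟨e₁, c₁⟩ := b₁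
    obtain ⟨e₂, c₂⟩ := b₂
    change e₁ = e₂ at he
    subst he
    have hc : c₁ = c₂ := congrArg Prod.snd hb
    subst hc
    rfl
  abuts_branchMap b v hv := by
    obtain ⟨⟨⟨s, n⟩, hp⟩, c⟩ := b
    cases c
    · have hv' : (⟨(s, n), hp⟩ : EscIdx K') = v := Option.some.inj hv
      subst hv'
      rfl
    · have hv' : escRep K' s (n + 1) = v := Option.some.inj hv
      subst hv'
      exact congrArg some (escRep_succ_fold h s n)

/-- The fold on vertices. [cite: MochizukiSemiAnbd2006, Thm 3.7(iii) p.41] -/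
@[simp] theorem escapeFold_vertexMap {K K' : ℕ} (h : K ≤ K') (p : EscIdx K') :
    (escapeFold h).vertexMap p = escRep K p.1.1 p.1.2 := rfl

/-- The fold on edges. [cite: MochizukiSemiAnbd2006, Thm 3.7(iii) p.41] -/
@[simp] theorem escapeFold_edgeMap {K K' : ℕ} (h : K ≤ K') (p : EscIdx K') :
    (escapeFold h).edgeMap p = escRep K p.1.1 p.1.2 := rfl

/-- The fold on branches. [cite: MochizukiSemiAnbd2006, Thm 3.7(iii) p.41] -/
@[simp] theorem escapeFold_branchMap {K K' : ℕ} (h : K ≤ K') (b : EscIdx K' × Bool) :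
    (escapeFold h).branchMap b = (escRep K b.1.1.1 b.1.1.2, b.2) := rfl

/-- The fold at `K ≤ K` is the identity. [cite: MochizukiSemiAnbd2006, Thm 3.7(iii) p.41] -/
theorem escapeFold_refl (K : ℕ) : escapeFold (le_refl K) = 𝟙 (escapeTree K) := by
  refine SemiGraph.Hom.ext ?_ ?_ ?_
  · funext p; exact escRep_self p
  · funext p; exact escRep_self p
  · funext b
    exact Prod.ext (escRep_self b.1) rfl

/-- The folds compose (functoriality of the tower). [cite: MochizukiSemiAnbd2006, Thm 3.7(iii) p.41] -/
theorem escapeFold_comp {K K' K'' : ℕ} (h : K ≤ K') (h' : K' ≤ K'') :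
    escapeFold h' ≫ escapeFold h = escapeFold (h.trans h') := by
  refine SemiGraph.Hom.ext ?_ ?_ ?_
  · funext p; exact escRep_escRep h p.1.1 p.1.2
  · funext p; exact escRep_escRep h p.1.1 p.1.2
  · funext b
    change (escRep K (escRep K' b.1.1.1 b.1.1.2).1.1 (escRep K' b.1.1.1 b.1.1.2).1.2, b.2) =
      (escRep K b.1.1.1 b.1.1.2, b.2)
    rw [escRep_escRep h]

/-- The folds are surjective on vertices. [cite: MochizukiSemiAnbd2006, Thm 3.7(iii) p.41] -/
theorem escapeFold_vertexMap_surjective {K K' : ℕ} (h : K ≤ K') :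
    Function.Surjective (escapeFold h).vertexMap := fun p =>
  ⟨⟨p.1, p.2.elim (fun h1 => Or.inl (lt_of_lt_of_le h1 h)) Or.inr⟩, escRep_self p⟩

/-- The folds preserve the height (second coordinate). [cite: MochizukiSemiAnbd2006, Thm 3.7(iii) p.41] -/
theorem escapeFold_vertexMap_snd {K K' : ℕ} (h : K ≤ K') (q : EscIdx K') :
    ((escapeFold h).vertexMap q).1.2 = q.1.2 := rfl

/-- The fibres of a fold over a vertex are finite (a point of the fibre over `(s, n)` is `(true, n)` or
`(false, n)`). [cite: MochizukiSemiAnbd2006, Thm 3.7(iii) p.41] -/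
theorem escapeFold_fibre_finite {K K' : ℕ} (h : K ≤ K') (p : EscIdx K) :
    Set.Finite ((escapeFold h).vertexMap ⁻¹' {p}) := by
  refine Set.Finite.of_injOn (f := fun q : EscIdx K' => q.1.1) (t := Set.univ)
    (fun _ _ => Set.mem_univ _) ?_ Set.finite_univ
  intro q₁ h₁ q₂ h₂ hs
  have e₁ : (escapeFold h).vertexMap q₁ = p := h₁
  have e₂ : (escapeFold h).vertexMap q₂ = p := h₂
  have n₁ : q₁.1.2 = p.1.2 := congrArg (fun r : EscIdx K => r.1.2) e₁
  have n₂ : q₂.1.2 = p.1.2 := congrArg (fun r : EscIdx K => r.1.2) e₂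
  exact EscIdx.ext (Prod.ext hs (n₁.trans n₂.symm))


/-! ### The swap involutions -/

/-- The swap on the index set of `Y_K`: `(s, n) ↦ (¬ s, n)` for `n < K`, the identity for `n ≥ K`.
[cite: MochizukiSemiAnbd2006, Thm 3.7(iii) p.41] -/
def escapeSwapIdx (K : ℕ) (p : EscIdx K) : EscIdx K :=
  ⟨(xor p.1.1 (decide (p.1.2 < K)), p.1.2), by
    obtain ⟨⟨s, n⟩, hp⟩ := p
    by_cases h : n < K
    · exact Or.inl h
    · right
      rcases hp with hp | hp
      · exact absurd hp h
      · simp only at hp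
        subst hp
        simp [h]⟩

/-- The underlying pair of a swapped point. [cite: MochizukiSemiAnbd2006, Thm 3.7(iii) p.41] -/
@[simp] theorem escapeSwapIdx_val (K : ℕ) (p : EscIdx K) :
    (escapeSwapIdx K p).1 = (xor p.1.1 (decide (p.1.2 < K)), p.1.2) := rfl

/-- The swap is an involution. [cite: MochizukiSemiAnbd2006, Thm 3.7(iii) p.41] -/
theorem escapeSwapIdx_escapeSwapIdx (K : ℕ) (p : EscIdx K) :
    escapeSwapIdx K (escapeSwapIdx K p) = p := by
  apply EscIdx.ext
  obtain ⟨⟨s, n⟩, hp⟩ := p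
  simp only [escapeSwapIdx_val, Prod.mk.injEq, and_true]
  cases s <;> by_cases h : n < K <;> simp [h]

/-- The upper end of the swapped edge is the swap of the upper end.
[cite: MochizukiSemiAnbd2006, Thm 3.7(iii) p.41] -/
theorem escRep_succ_swap (K : ℕ) (s : Bool) (n : ℕ) :
    escRep K (xor s (decide (n < K))) (n + 1) = escapeSwapIdx K (escRep K s (n + 1)) := by
  apply EscIdx.ext
  simp only [escapeSwapIdx_val, escRep_val, Prod.mk.injEq, and_true]
  by_cases h1 : n + 1 < K
  · have h2 : n < K := by omega
    simp [h1, h2]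
  · simp [h1]

/-- **The swap** of `Y_K` as a morphism of semi-graphs: exchanges the arm `(true, n), n < K` with the
initial segment `(false, n), n < K` of the line and fixes the tail `(false, n), n ≥ K`.
[cite: MochizukiSemiAnbd2006, Thm 3.7(iii) p.41] -/
def escapeSwap (K : ℕ) : escapeTree K ⟶ escapeTree K where
  vertexMap := escapeSwapIdx K
  edgeMap := escapeSwapIdx K
  branchMap b := (escapeSwapIdx K b.1, b.2)
  edgeOf_branchMap _ := rfl
  branchMap_injOn b₁ b₂ he hb := by
    obtain ⟨e₁, c₁⟩ := b₁
    obtain ⟨e₂, c₂⟩ := b₂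
    change e₁ = e₂ at he
    subst he
    have hc : c₁ = c₂ := congrArg Prod.snd hb
    subst hc
    rfl
  abuts_branchMap b v hv := by
    obtain ⟨⟨⟨s, n⟩, hp⟩, c⟩ := b
    cases c
    · have hv' : (⟨(s, n), hp⟩ : EscIdx K) = v := Option.some.inj hv
      subst hv'
      rfl
    · have hv' : escRep K s (n + 1) = v := Option.some.inj hv
      subst hv'
      exact congrArg some (escRep_succ_swap K s n)

/-- The swap on vertices. [cite: MochizukiSemiAnbd2006, Thm 3.7(iii) p.41] -/
@[simp] theorem escapeSwap_vertexMap (K : ℕ) (p : EscIdx K) :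
    (escapeSwap K).vertexMap p = escapeSwapIdx K p := rfl

/-- The swap squares to the identity morphism. [cite: MochizukiSemiAnbd2006, Thm 3.7(iii) p.41] -/
theorem escapeSwap_comp_escapeSwap (K : ℕ) : escapeSwap K ≫ escapeSwap K = 𝟙 (escapeTree K) := by
  refine SemiGraph.Hom.ext ?_ ?_ ?_
  · funext p; exact escapeSwapIdx_escapeSwapIdx K p
  · funext p; exact escapeSwapIdx_escapeSwapIdx K p
  · funext b
    exact Prod.ext (escapeSwapIdx_escapeSwapIdx K b.1) rfl

/-- At `K = 0` (the base ray) the swap is the identity. [cite: MochizukiSemiAnbd2006, Thm 3.7(iii) p.41] -/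
theorem escapeSwap_zero : escapeSwap 0 = 𝟙 (escapeTree 0) := by
  have key : ∀ p : EscIdx 0, escapeSwapIdx 0 p = p := fun p => EscIdx.ext (by simp)
  refine SemiGraph.Hom.ext ?_ ?_ ?_
  · funext p; exact key p
  · funext p; exact key p
  · funext b
    exact Prod.ext (key b.1) rfl

/-- **The swap as an automorphism** of `Y_K` (an involution). [cite: MochizukiSemiAnbd2006, Thm 3.7(iii) p.41] -/
def escapeSwapIso (K : ℕ) : Aut (escapeTree K) where
  hom := escapeSwap K
  inv := escapeSwap K
  hom_inv_id := escapeSwap_comp_escapeSwap K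
  inv_hom_id := escapeSwap_comp_escapeSwap K

/-- The swap squares to the identity in `Aut Y_K`. [cite: MochizukiSemiAnbd2006, Thm 3.7(iii) p.41] -/
theorem escapeSwapIso_mul_self (K : ℕ) : escapeSwapIso K * escapeSwapIso K = 1 := by
  apply Iso.ext
  change escapeSwap K ≫ escapeSwap K = 𝟙 _
  exact escapeSwap_comp_escapeSwap K

/-- **The action** of `ℤ` on `Y_K` through the swap (it factors through `ℤ/2`).
[cite: MochizukiSemiAnbd2006, Thm 3.7(iii) p.41] -/
noncomputable def escapeAct (K : ℕ) : Multiplicative ℤ →* Aut (escapeTree K) :=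
  zpowersHom (Aut (escapeTree K)) (escapeSwapIso K)

/-- Every element acts as the identity (even exponent) or as the swap (odd exponent).
[cite: MochizukiSemiAnbd2006, Thm 3.7(iii) p.41] -/
theorem escapeAct_eq (K : ℕ) (γ : Multiplicative ℤ) :
    escapeAct K γ = if γ.toAdd % 2 = 0 then 1 else escapeSwapIso K := by
  have h2 : escapeSwapIso K ^ (2 : ℤ) = 1 := by
    rw [show (2 : ℤ) = ((2 : ℕ) : ℤ) from rfl, zpow_natCast, pow_two, escapeSwapIso_mul_self]
  have hγ : escapeAct K γ = escapeSwapIso K ^ (γ.toAdd % 2) := by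
    change escapeSwapIso K ^ γ.toAdd = _
    exact zpow_eq_zpow_emod _ h2
  have hpar : γ.toAdd % 2 = 0 ∨ γ.toAdd % 2 = 1 := by omega
  rcases hpar with h | h
  · rw [hγ, h, zpow_zero, if_pos rfl]
  · rw [hγ, h, zpow_one, if_neg (by omega)]

/-- The generator acts as the swap. [cite: MochizukiSemiAnbd2006, Thm 3.7(iii) p.41] -/
theorem escapeAct_ofAdd_one (K : ℕ) : escapeAct K (Multiplicative.ofAdd 1) = escapeSwapIso K := by
  rw [escapeAct_eq]
  simp

/-- The action on the base ray `Y_0` is trivial. [cite: MochizukiSemiAnbd2006, Thm 3.7(iii) p.41] -/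
theorem escapeAct_zero_hom (γ : Multiplicative ℤ) : (escapeAct 0 γ).hom = 𝟙 (escapeTree 0) := by
  rw [escapeAct_eq]
  split_ifs
  · rfl
  · exact escapeSwap_zero

/-- A vertex is fixed by the whole action iff it lies on the tail `n ≥ K` (iff it is fixed by the swap).
[cite: MochizukiSemiAnbd2006, Thm 3.7(iii) p.41] -/
theorem escapeAct_fixed_iff (K : ℕ) (p : EscIdx K) :
    (∀ γ : Multiplicative ℤ, (escapeAct K γ).hom.vertexMap p = p) ↔ K ≤ p.1.2 := by
  constructor
  · intro h
    have h1 := h (Multiplicative.ofAdd 1)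
    rw [escapeAct_ofAdd_one] at h1
    have h2 := congrArg (fun r : EscIdx K => r.1.1) h1
    change xor p.1.1 (decide (p.1.2 < K)) = p.1.1 at h2
    by_contra hlt
    have h3 : decide (p.1.2 < K) = true := by simp; omega
    rw [h3] at h2
    revert h2
    cases p.1.1 <;> simp
  · intro hK γ
    rw [escapeAct_eq]
    split_ifs with h
    · rfl
    · apply EscIdx.ext
      change (xor p.1.1 (decide (p.1.2 < K)), p.1.2) = p.1
      have h3 : decide (p.1.2 < K) = false := by simp; omega
      rw [h3, Bool.xor_false]

/-- Equivariance of the folds for the swaps: fold after swap is swap after fold.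
[cite: MochizukiSemiAnbd2006, Thm 3.7(iii) p.41] -/
theorem escapeSwap_comp_escapeFold {K K' : ℕ} (h : K ≤ K') :
    escapeSwap K' ≫ escapeFold h = escapeFold h ≫ escapeSwap K := by
  have key : ∀ (s : Bool) (n : ℕ),
      escRep K (xor s (decide (n < K'))) n = escapeSwapIdx K (escRep K s n) := by
    intro s n
    apply EscIdx.ext
    simp only [escRep_val, escapeSwapIdx_val, Prod.mk.injEq, and_true]
    by_cases h1 : n < K
    · have h2 : n < K' := by omega
      simp [h1, h2]
    · simp [h1]
  refine SemiGraph.Hom.ext ?_ ?_ ?_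
  · funext p; exact key p.1.1 p.1.2
  · funext p; exact key p.1.1 p.1.2
  · funext b
    change (escRep K (xor b.1.1.1 (decide (b.1.1.2 < K'))) b.1.1.2, b.2) =
      (escapeSwapIdx K (escRep K b.1.1.1 b.1.1.2), b.2)
    rw [key b.1.1.1 b.1.1.2]

/-- Equivariance of the folds for the whole action. [cite: MochizukiSemiAnbd2006, Thm 3.7(iii) p.41] -/
theorem escapeAct_comp_escapeFold {K K' : ℕ} (h : K ≤ K') (γ : Multiplicative ℤ) :
    (escapeAct K' γ).hom ≫ escapeFold h = escapeFold h ≫ (escapeAct K γ).hom := by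
  rw [escapeAct_eq, escapeAct_eq]
  split_ifs
  · rfl
  · exact escapeSwap_comp_escapeFold h


end SemiGraph

end Literature.AnabelianGeometry.SemiGraphs
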